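import Literature.AlgebraicGeometry.Resolution.ProjectiveModels
import Literature.AlgebraicGeometry.Resolution.ResolutionProjectiveReduction
import Literature.AlgebraicGeometry.Resolution.ZariskiFiniteness
import Mathlib.AlgebraicGeometry.FunctionField
import HarnessLib

/-!
# Projective models from affine charts: projective closures of affine models

Topic: `Literature/AlgebraicGeometry/Resolution`. Constructions of projective models
(`ProjModel`, `ProjectiveModels.lean`) of a field `K/k`, all PROVED:

* `isIso_stalkClosedPointTo_of_isFractionRing` — for a domain `A` with fraction field `K`, the
  morphism `Spec K → Spec A` identifies `K` with the local ring of `Spec A` at the generic point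
  (`𝒪_{Spec A,(0)} = A_{(0)} → K` is an isomorphism).
* `ProjModel.ofChart` — a projective integral `k`-scheme `X` together with an open immersion
  `j : Spec A ↪ X` over `k` of the spectrum of a `k`-algebra `A` with `Frac A = K` is a projective
  model of `K/k` (generic point `Spec K → Spec A ↪ X`); `ProjModel.ofChart_isCentre`,
  `ProjModel.ofChart_regCentre` — for `𝒪_v ⊇ A` the centre of `v` on it is the point
  `𝔪_v ∩ A` of the chart, and it is a regular centre iff `A_{𝔪_v ∩ A}` is regular.
* `ProjModel.exists_regCentre_of_hasRegularCentre` — **projective closure of an affine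
  model**: for a finitely generated `k`-subalgebra `T ⊆ K` with `Frac T = K` there is a
  projective model `X̄_T` of `K/k` (the schematic closure of `Spec T ↪ 𝐀ⁿ_k ⊆ ℙⁿ_k`,
  `ChowLemmaProof.exists_immersion_projectiveSpace` + Mathlib's scheme-theoretic image) on which
  every valuation ring `𝒪_w ⊇ T` with `T_{𝔪_w ∩ T}` regular (`HasRegularCentre T w`,
  `ZariskiFiniteness.lean`) has a regular centre. This is the sentence "Regularity is a nonempty
  open property … This applies in particular to any projective closure of `Spec T`, `T` as in
  (LU)" of Cossart–Piltant 2019, proof of Prop. 4.6, Step 3, and Piltant 2013, Axiom 5 ⇒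
  projective models (via Chow) in §2.
* `isoSpec_inv_comp` — bookkeeping: for an affine `Y` over `Spec R`,
  `Y ≅ Spec Γ(Y) → Spec R` is `Spec` of `R → Γ(Y)`.

## References

* V. Cossart, O. Piltant, J. Algebra 529 (2019), proof of Prop. 4.6 (arXiv:1412.0868v1:
  Prop. 4.4), Step 3. [CossartPiltant2019]
* O. Zariski, P. Samuel, *Commutative Algebra* II, Ch. VI §17 (projective models, centres).
  [ZariskiSamuel1960]
* U. Görtz, T. Wedhorn, *Algebraic Geometry I*, 2nd ed. (2020), §(12.15), Thm. 13.100 Step 2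
  (affine of finite type ⇒ quasi-projective; schematic closure). [GortzWedhorn2020]
-/

noncomputable section

open CategoryTheory AlgebraicGeometry TopologicalSpace IsLocalRing

namespace Literature.AlgebraicGeometry.Resolution

universe u

/-! ## The generic stalk of `Spec A` is the fraction field -/

/-- The closed point of `Spec K`, `K` a field, maps to the generic point of `Spec A` under
`Spec K → Spec A` for an injective `A → K`, `A` a domain. [folklore] -/
theorem specMap_closedPoint_eq_genericPoint (A K : Type u) [CommRing A] [IsDomain A] [Field K]
    [Algebra A K] (hinj : Function.Injective (algebraMap A K)) :
    Spec.map (CommRingCat.ofHom (algebraMap A K)) (closedPoint K) =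
      genericPoint (Spec (CommRingCat.of A)) := by
  rw [genericPoint_eq_bot_of_affine]
  apply PrimeSpectrum.ext
  change Ideal.comap (algebraMap A K) (closedPoint K).asIdeal = ⊥
  have h0 : (closedPoint K).asIdeal = ⊥ := by
    change maximalIdeal K = ⊥
    exact (isField_iff_maximalIdeal_eq.mp (Field.toIsField K))
  rw [h0]
  exact Ideal.comap_bot_of_injective _ hinj

/-- **`𝒪_{Spec A,(0)} → K` is an isomorphism** for a domain `A` with fraction field `K`: the
local ring homomorphism induced by `Spec K → Spec A` at the closed point of `Spec K` (Mathlib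
`Scheme.stalkClosedPointTo`) is the comparison of two fraction fields of `A` (the stalk is the
localisation of `A` at the generic point `(0)`, `StructureSheaf.IsLocalization.to_stalk`).
[folklore] -/
theorem isIso_stalkClosedPointTo_of_isFractionRing (A K : Type u) [CommRing A] [IsDomain A]
    [Field K] [Algebra A K] [IsFractionRing A K] :
    IsIso (Scheme.stalkClosedPointTo (Spec.map (CommRingCat.ofHom (algebraMap A K)))) := by
  set φ : CommRingCat.of A ⟶ CommRingCat.of K := CommRingCat.ofHom (algebraMap A K) with hφ
  set p : ↥(Spec (CommRingCat.of A)) := Spec.map φ (closedPoint K) with hpdef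
  -- the stalk as a localisation of `A` at `p = (0)`
  let S : CommRingCat.{u} := (Spec.structureSheaf A).presheaf.stalk p
  letI : Algebra A S := StructureSheaf.stalkAlgebra A p
  haveI : IsLocalization.AtPrime S p.asIdeal := StructureSheaf.IsLocalization.to_stalk A p
  have hp : p = genericPoint (Spec (CommRingCat.of A)) :=
    specMap_closedPoint_eq_genericPoint A K (IsFractionRing.injective A K)
  have hp0 : p.asIdeal = ⊥ := by
    rw [hp, genericPoint_eq_bot_of_affine]
    rfl
  have hM : p.asIdeal.primeCompl = nonZeroDivisors A := by
    ext x
    rw [mem_nonZeroDivisors_iff_ne_zero]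
    change x ∉ p.asIdeal ↔ x ≠ 0
    rw [hp0, Ideal.mem_bot]
  haveI : IsFractionRing A S := by
    change IsLocalization (nonZeroDivisors A) S
    rw [← hM]
    infer_instance
  -- the comparison with `K`
  let ψ : S ⟶ CommRingCat.of K := Scheme.stalkClosedPointTo (Spec.map φ)
  change IsIso ψ
  let e : S ≃ₐ[A] K := IsLocalization.algEquiv (nonZeroDivisors A) S K
  have key : StructureSheaf.toStalk A p ≫ ψ = φ := by
    change (Scheme.ΓSpecIso (.of A)).inv ≫ (Spec (.of A)).presheaf.germ ⊤ p trivial ≫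
      Scheme.stalkClosedPointTo (Spec.map φ) = φ
    rw [Scheme.germ_stalkClosedPointTo_Spec, Iso.inv_hom_id_assoc]
  have hψe : ψ.hom = (e : S →+* K) := by
    refine IsLocalization.ringHom_ext (nonZeroDivisors A) ?_
    ext a
    have h1 : ψ.hom (algebraMap A S a) = algebraMap A K a := by
      have := congrArg (fun g : CommRingCat.of A ⟶ CommRingCat.of K => g.hom a) key
      exact this
    rw [RingHom.comp_apply, RingHom.comp_apply, h1]
    exact (e.commutes a).symm
  let e' : S ≅ CommRingCat.of K :=
    { hom := ψ
      inv := CommRingCat.ofHom (e.symm : K →+* S)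
      hom_inv_id := by
        ext x
        change e.symm (ψ.hom x) = x
        rw [hψe]
        exact e.symm_apply_apply x
      inv_hom_id := by
        ext y
        change ψ.hom (e.symm y) = y
        rw [hψe]
        exact e.apply_symm_apply y }
  exact e'.isIso_hom

/-! ## Affine schemes over `Spec R` -/

/-- For an affine scheme `Y` over `Spec R`, the structure morphism read through `Y ≅ Spec Γ(Y)`
is `Spec` of the ring map `R → Γ(Y)`. [folklore] -/
theorem isoSpec_inv_comp {Y : Scheme.{u}} [IsAffine Y] {R : CommRingCat.{u}} (g : Y ⟶ Spec R) :
    Y.isoSpec.inv ≫ g = Spec.map ((Scheme.ΓSpecIso R).inv ≫ g.appTop) := by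
  rw [Iso.inv_comp_eq, Scheme.isoSpec_hom, Spec.map_comp, ← Scheme.toSpecΓ_naturality_assoc,
    toSpecΓ_SpecMap_ΓSpecIso_inv, Category.comp_id]

/-! ## Projective models from a chart -/

namespace ProjModel

variable {k K : Type u} [Field k] [Field K] [Algebra k K]

section OfChart

variable (X : Scheme.{u}) [IsIntegral X] (πX : X ⟶ Spec (.of k))
  (hproj : Motives.IsProjectiveOver (Over.mk πX))
  (A : Type u) [CommRing A] [IsDomain A] [Algebra k A] [Algebra A K] [IsScalarTower k A K]
  [IsFractionRing A K]
  (j : Spec (.of A) ⟶ X) [IsOpenImmersion j]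
  (hj : j ≫ πX = Spec.map (CommRingCat.ofHom (algebraMap k A)))

/-- **A projective integral `k`-scheme with an affine chart `Spec A`, `Frac A = K`, is a
projective model of `K/k`**: the distinguished `K`-point is `Spec K → Spec A ↪ X`, the generic
point (Zariski–Samuel II, Ch. VI §17: a projective model of `K/k` and its affine
representatives). [cite: ZariskiSamuel1960, Ch. VI §17] -/
def ofChart : ProjModel k K where
  X := X
  π := πX
  gen := Spec.map (CommRingCat.ofHom (algebraMap A K)) ≫ j
  gen_π := by
    rw [Category.assoc, hj, ← Spec.map_comp, ← CommRingCat.ofHom_comp,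
      ← IsScalarTower.algebraMap_eq]
  isIntegral := ‹_›
  isProjectiveOver := hproj
  genericPt_eq := by
    rw [Scheme.Hom.comp_apply, specMap_closedPoint_eq_genericPoint A K
      (IsFractionRing.injective A K)]
    exact genericPoint_eq_of_isOpenImmersion j
  isIso_stalkClosedPointTo := by
    rw [Scheme.stalkClosedPointTo_comp]
    have h : ∀ x, IsIso (j.stalkMap x) := fun x => inferInstance
    exact IsIso.comp_isIso' (h _) (isIso_stalkClosedPointTo_of_isFractionRing A K)

/-- The underlying scheme of `ofChart`. [folklore] -/
@[simp]
theorem ofChart_X : (ofChart X πX hproj A j hj : ProjModel k K).X = X := rfl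

/-- The structure morphism of `ofChart`. [folklore] -/
@[simp]
theorem ofChart_π : (ofChart X πX hproj A j hj : ProjModel k K).π = πX := rfl

/-- The distinguished point of `ofChart`. [folklore] -/
theorem ofChart_gen :
    (ofChart X πX hproj A j hj : ProjModel k K).gen =
      Spec.map (CommRingCat.ofHom (algebraMap A K)) ≫ j := rfl

variable (v : ZariskiRiemannSpace k K) (g : A →+* v.asValuationSubring)
  (hg : ∀ a, ((g a : v.asValuationSubring) : K) = algebraMap A K a)

include hg in
/-- **The centre on a chart.** If `𝒪_v ⊇ A` (a ring map `g : A → 𝒪_v` compatible with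
`A → K`), the centre of `v` on `ofChart` is the point `g⁻¹(𝔪_v) = 𝔪_v ∩ A` of the chart
`Spec A`: the lift is `Spec 𝒪_v → Spec A ↪ X` (Zariski–Samuel II, Ch. VI §17: the centre of a
valuation on an affine model is `𝔪_v ∩ A`). [cite: ZariskiSamuel1960, Ch. VI §17] -/
theorem ofChart_isCentre :
    (ofChart X πX hproj A j hj : ProjModel k K).IsCentre v
      (j (Spec.map (CommRingCat.ofHom g) (closedPoint v.asValuationSubring))) := by
  refine ⟨Spec.map (CommRingCat.ofHom g) ≫ j, ?_, ?_, rfl⟩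
  · -- restricts to `gen` on `Spec K`
    rw [ofChart_gen, KModel.specKTo, ← Spec.map_comp_assoc, ← CommRingCat.ofHom_comp]
    congr 3
    ext a
    exact hg a
  · -- lies over `Spec 𝒪_v → Spec k`
    change Spec.map (CommRingCat.ofHom g) ≫ j ≫ πX = KModel.specOTo v
    rw [hj, ← Spec.map_comp, ← CommRingCat.ofHom_comp, KModel.specOTo]
    congr 2
    ext c
    change ((g (algebraMap k A c) : v.asValuationSubring) : K) = algebraMap k K c
    rw [hg, ← IsScalarTower.algebraMap_apply]

include hg in
/-- **Regular centre on a chart**: if `A_{𝔪_v ∩ A}` is a regular local ring then `v` has a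
regular centre on `ofChart` (the local ring of `X` at a point of the open chart `Spec A` is the
localisation of `A`, `StructureSheaf.stalkIso`). [cite: ZariskiSamuel1960, Ch. VI §17] -/
theorem ofChart_regCentre
    (hreg : IsRegularLocalRing
      (Localization.AtPrime (Ideal.comap g (maximalIdeal v.asValuationSubring)))) :
    (ofChart X πX hproj A j hj : ProjModel k K).RegCentre v := by
  rw [regCentre_iff]
  refine ⟨_, ofChart_isCentre X πX hproj A j hj v g hg, ?_⟩
  set y : ↥(Spec (CommRingCat.of A)) :=
    Spec.map (CommRingCat.ofHom g) (closedPoint v.asValuationSubring) with hydef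
  have hy : y.asIdeal = Ideal.comap g (maximalIdeal v.asValuationSubring) := rfl
  -- `A_y ≅ 𝒪_{Spec A, y} ≅ 𝒪_{X, j y}`
  haveI h1 : IsRegularLocalRing (Localization.AtPrime y.asIdeal) := hreg
  haveI h2 : IsRegularLocalRing ((Spec.structureSheaf A).presheaf.stalk y) :=
    IsRegularLocalRing.of_ringEquiv (StructureSheaf.stalkIso A y).toRingEquiv
  have h3 : IsRegularLocalRing ((Spec (CommRingCat.of A)).presheaf.stalk y) := h2
  change IsRegularLocalRing (X.presheaf.stalk (j y))
  exact IsRegularLocalRing.of_ringEquiv (asIso (j.stalkMap y)).commRingCatIsoToRingEquiv.symm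

end OfChart

/-! ## Projective closures of affine models -/

/-- **Projective closure of an affine model.** For a finitely generated `k`-subalgebra
`T ⊆ K` with `Frac T = K` there is a projective model of `K/k` on which every valuation ring
`𝒪_w ⊇ T` whose centre `𝔪_w ∩ T` on `T` is regular (`HasRegularCentre T w`) has a regular
centre: the schematic closure `X̄` of `Spec T ↪ ℙⁿ_k` (an affine `k`-scheme of finite type is
quasi-projective, `ChowLemmaProof.exists_immersion_projectiveSpace`; the image of the
quasi-compact immersion is an integral closed subscheme of `ℙⁿ_k` containing `Spec T` as an
open, Mathlib `Scheme.Hom.toImage`), read through `ofChart`. This is "any projective closure of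
`Spec T`, `T` as in (LU)" in Cossart–Piltant's Step 3, and the passage from affine to
projective uniformizing models in Zariski–Samuel II, Ch. VI §17 / Piltant 2013, §2 (Axiom 5).
[cite: CossartPiltant2019, Prop. 4.6 (arXiv v1: Prop. 4.4), proof, Step 3] -/
theorem exists_regCentre_of_hasRegularCentre (T : Subalgebra k K) (hT : T.FG)
    [IsFractionRing T K] :
    ∃ M : ProjModel k K, ∀ w : ZariskiRiemannSpace k K,
      ZariskiRiemannSpace.HasRegularCentre T w → M.RegCentre w := by
  haveI : Algebra.FiniteType k T := T.fg_iff_finiteType.mp hT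
  let Y : Scheme.{u} := Spec (CommRingCat.of T)
  let gY : Y ⟶ Spec (.of k) := Spec.map (CommRingCat.ofHom (algebraMap k T))
  haveI : LocallyOfFiniteType gY :=
    (HasRingHomProperty.Spec_iff (P := @LocallyOfFiniteType)).mpr
      (RingHom.finiteType_algebraMap.mpr ‹_›)
  obtain ⟨n, ρ, hρ, hρg⟩ := ChowLemmaProof.exists_immersion_projectiveSpace k gY
  haveI := hρ
  haveI : NoetherianSpace Y := noetherianSpace_of_isImmersion_projectiveSpace ρ
  haveI : QuasiCompact ρ := inferInstance
  haveI : IsIntegral ρ.image := ChowLemmaProof.isIntegral_image ρ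
  haveI : IsProper (Motives.projectiveSpace n k).hom := Motives.isProper_projectiveSpace n k
  let πX : ρ.image ⟶ Spec (.of k) := ρ.imageι ≫ (Motives.projectiveSpace n k).hom
  have hproj : Motives.IsProjectiveOver (Over.mk πX) :=
    ⟨n, Over.homMk ρ.imageι rfl, inferInstanceAs (IsClosedImmersion ρ.imageι)⟩
  have hj : ρ.toImage ≫ πX = Spec.map (CommRingCat.ofHom (algebraMap k T)) := by
    change ρ.toImage ≫ ρ.imageι ≫ (Motives.projectiveSpace n k).hom = _
    rw [Scheme.Hom.toImage_imageι_assoc, hρg]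
  refine ⟨ofChart ρ.image πX hproj T ρ.toImage hj, fun w hw => ?_⟩
  obtain ⟨hle, hreg⟩ := hw
  exact ofChart_regCentre ρ.image πX hproj T ρ.toImage hj w
    (Subring.inclusion hle : T.toSubring →+* w.asValuationSubring.toSubring) (fun a => rfl) hreg

end ProjModel

end Literature.AlgebraicGeometry.Resolution

end
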